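import Summits.HodgeConjecture.HodgeConjecture.Theses.HolomorphicityRate
import HarnessLib

/-!
# Strategist sketch — crux `CarrierCurvatureDecay` (stmt-HodgeConjecture-18021)

Typed objects used by STRATEGY-CENSUS.md and the two crux ideas:
* `CarrierConclusion` — the existential conclusion of the crux, factored out;
* `HasHolExponent` — "the carrier `F` has holomorphicity exponent `≥ η` in the metric `g`":
  for every curvature budget `K ≥ 1` some unitary connection has `|F_D| ≤ K` and
  `|F_D^{0,2}| ≤ C·K^{-η}` (reformulation: crux ⟺ some carrier has exponent `> p - 1`);
* `stub_reindex` — exponent `> p - 1` ⟹ the crux's `k`-indexed family (first lemma of idea A);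
* `CurvatureGapWitness`, `not_crux_of_gap` — the typed refutation target (idea N);
* `zeroTwo_small_of_oneOne_nearby` — pointwise lemma of the tempered-transport attempt (census §Transfer).
-/

noncomputable section

namespace Summit.HodgeConjecture.HodgeConjecture.Cruxes.CarrierCurvatureDecay.Strategist

open scoped Manifold ContDiff Topology
open Literature.AlgebraicGeometry.HodgeTheory Literature.AlgebraicGeometry.Motives
  Literature.Geometry.Kaehler

/-- The conclusion of the crux for one instance `(n, p, X, A, c)`. -/
def CarrierConclusion (n p : ℕ) (X : SchemeOver ℂ) (A : HodgeModel n X)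
    (c : complexBetti X (2 * p)) : Prop :=
  ∃ (g : Bundle.ContMDiffRiemannianMetric 𝓘(ℝ, A.model) ((⊤ : ℕ∞) : WithTop ℕ∞) A.model
      (fun x : A.carrier => TangentSpace 𝓘(ℝ, A.model) x))
    (F : SmoothHermitianBundle A.model A.carrier) (m : ℕ) (C δ : ℝ)
    (D : ℕ → UnitaryConnection A.model F.Fiber F.metric),
    0 < m ∧ 0 < δ ∧ F.rank = p ∧ (∀ i : ℕ, 0 < i → i < p → F.chernCharacter A.deRham i = 0) ∧
    ((-1 : ℂ) ^ (p - 1) * ((p - 1).factorial : ℂ)) • F.chernCharacter A.deRham p =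
      (m : ℂ) • A.pullback (2 * p) c ∧
    ∀ᶠ k : ℕ in Filter.atTop, ∀ (x : A.carrier) (v w : TangentSpace 𝓘(ℝ, A.model) x),
      endNormSq (F.metric.frameOp x x) ((D k).curvature x x ![v, w]) ≤
          (C * (k : ℝ) ^ (1 - δ)) ^ 2 * (g.inner x v v * g.inner x w w) ∧
        endNormSq (F.metric.frameOp x x) ((D k).curvatureZeroTwo x x ![v, w]) ≤
          (C * (k : ℝ) ^ (1 - (p : ℝ) - δ)) ^ 2 * (g.inner x v v * g.inner x w w)

/-- The crux, by name, unfolds to `∀ instances, hypotheses → CarrierConclusion`. -/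
theorem crux_iff :
    Summit.HodgeConjecture.HodgeConjecture.Theses.HolomorphicityRate.CarrierCurvatureDecay ↔
      ∀ (n p : ℕ) (X : SchemeOver ℂ), IsSmoothProjective n X → 1 ≤ p → p < n →
        ∀ (A : HodgeModel n X), A.IsChernNormalised → ∀ (c : complexBetti X (2 * p)),
          IsRationalClass c → A.pullback (2 * p) c ∈ A.hodgePQ (2 * p) p p →
            CarrierConclusion n p X A c :=
  Iff.rfl

/-- **Holomorphicity exponent.** `F` (with the metric `g` on the base) has holomorphicity
exponent at least `η`: for every curvature budget `K ≥ 1` there is a unitary connection with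
`|F_D|_{g,h} ≤ K` and `|F_D^{0,2}|_{g,h} ≤ C K^{-η}` pointwise. The function
`μ_F(K) = inf_D {sup |F_D^{0,2}| : sup |F_D| ≤ K}` is non-increasing in `K`; `HasHolExponent F η`
says `μ_F(K) = O(K^{-η})`. -/
def HasHolExponent {n : ℕ} {X : SchemeOver ℂ} (A : HodgeModel n X)
    (g : Bundle.ContMDiffRiemannianMetric 𝓘(ℝ, A.model) ((⊤ : ℕ∞) : WithTop ℕ∞) A.model
      (fun x : A.carrier => TangentSpace 𝓘(ℝ, A.model) x))
    (F : SmoothHermitianBundle A.model A.carrier) (η : ℝ) : Prop :=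
  ∃ C : ℝ, ∀ K : ℝ, 1 ≤ K → ∃ D : UnitaryConnection A.model F.Fiber F.metric,
    ∀ (x : A.carrier) (v w : TangentSpace 𝓘(ℝ, A.model) x),
      endNormSq (F.metric.frameOp x x) (D.curvature x x ![v, w]) ≤
          K ^ 2 * (g.inner x v v * g.inner x w w) ∧
        endNormSq (F.metric.frameOp x x) (D.curvatureZeroTwo x x ![v, w]) ≤
          (C * K ^ (-η)) ^ 2 * (g.inner x v v * g.inner x w w)

/-- **First lemma of idea A (reindexing; pure real analysis + choice).** A carrier of the right
topological type with holomorphicity exponent `η > p - 1` yields the crux's `k`-indexed family: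
choose `δ > 0` with `η (1 - δ) ≥ p - 1 + δ` and `D k :=` the connection at budget `K = k^{1-δ}`. -/
theorem stub_reindex {n p : ℕ} {X : SchemeOver ℂ} (A : HodgeModel n X)
    (c : complexBetti X (2 * p))
    (g : Bundle.ContMDiffRiemannianMetric 𝓘(ℝ, A.model) ((⊤ : ℕ∞) : WithTop ℕ∞) A.model
      (fun x : A.carrier => TangentSpace 𝓘(ℝ, A.model) x))
    (F : SmoothHermitianBundle A.model A.carrier) (m : ℕ) (η : ℝ)
    (hm : 0 < m) (hrank : F.rank = p)
    (hlow : ∀ i : ℕ, 0 < i → i < p → F.chernCharacter A.deRham i = 0)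
    (htop : ((-1 : ℂ) ^ (p - 1) * ((p - 1).factorial : ℂ)) • F.chernCharacter A.deRham p =
      (m : ℂ) • A.pullback (2 * p) c)
    (hη : (p : ℝ) - 1 < η) (hexp : HasHolExponent A g F η) :
    CarrierConclusion n p X A c := by
  sorry

/-- **Typed refutation target (idea N).** One instance of the crux's hypotheses at which NO
carrier family exists: a curvature gap. -/
def CurvatureGapWitness : Prop :=
  ∃ (n p : ℕ) (X : SchemeOver ℂ) (_ : IsSmoothProjective n X) (_ : 1 ≤ p) (_ : p < n)
    (A : HodgeModel n X) (_ : A.IsChernNormalised) (c : complexBetti X (2 * p))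
    (_ : IsRationalClass c) (_ : A.pullback (2 * p) c ∈ A.hodgePQ (2 * p) p p),
    ¬ CarrierConclusion n p X A c

/-- A curvature-gap witness refutes the crux (logic only; this is the shape a `Negative/` lemma
would take). -/
theorem not_crux_of_gap (h : CurvatureGapWitness) :
    ¬ Summit.HodgeConjecture.HodgeConjecture.Theses.HolomorphicityRate.CarrierCurvatureDecay := by
  rintro hcrux
  obtain ⟨n, p, X, hX, hp, hpn, A, hA, c, hc, hpp, hno⟩ := h
  exact hno (hcrux n p X hX hp hpn A hA c hc hpp)

/-- **Pointwise lemma of the tempered-transport attempt (census §Transfer).** On the model space: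
if a `2`-form `β` is of type `(1,1)` for an operator `J'` (`β(J'v, J'w) = β(v, w)`) and
`‖J' - J‖ ≤ ε`, `‖J‖ ≤ 1`, then its `J`-anti-invariant part — twice the real part of the
`(2,0)+(0,2)` component — is `O(ε)|β|`. -/
theorem zeroTwo_small_of_oneOne_nearby {E W : Type*} [NormedAddCommGroup E] [NormedSpace ℝ E]
    [NormedAddCommGroup W] [NormedSpace ℝ W]
    (β : E [⋀^Fin 2]→L[ℝ] W) (J J' : E →L[ℝ] E) (ε : ℝ) (hε : 0 ≤ ε)
    (hJ : ‖J' - J‖ ≤ ε) (hJ1 : ‖J‖ ≤ 1)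
    (h11 : ∀ v w : E, β ![J' v, J' w] = β ![v, w]) (v w : E) :
    ‖β ![v, w] - β ![J v, J w]‖ ≤ (2 + ε) * ε * ‖β‖ * ‖v‖ * ‖w‖ := by
  sorry

end Summit.HodgeConjecture.HodgeConjecture.Cruxes.CarrierCurvatureDecay.Strategist
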